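import Mathlib

/-!
# T⁴ programme, spine node NE2 (U1a, η-rate of the linear theory) — THE COVARIANT AVERAGING TOWER:
# abstract one-step law ⟹ convergent unit-lattice tower with rate (kernel reduction), and the U ≠ 1 wall input
# of NE2 TYPED as a named `Prop`

Eighth generation of the NE2 prover lineage P1 of the cell `pub-balaban` (first prover-role generation; technique
«transfer King's scalar η-rate machinery ([King1986] Lemmas 4.3/4.5, (2.10)) to Bałaban's vector / background layers
via the [B5] propagator representations»), file 1 of the generation.

WHAT THIS FILE IS.  The lineage's accepted Literature leaves prove, AT `U = 1` on every finite torus, ONE-STEP LAWS of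
the shape `‖Q X^{(η/L)} Qᴴ − L^{−d}·X^{(η)}‖ ≤ L^{−d}·C·η` for the six items `X` of [B5] (1.89) against King's block
averaging `Q` ((2.10); `B5G183RateTorusW.opNorm_Qavg_calG_rate` …) and assemble them into convergent unit-lattice towers
(`B5G183RateUnitTower.unitAvg_tendsto`, rate `L^{−k}`).  That assembly hard-wires ONE averaging operator (King's `Qavg`)
at every level.  The present file isolates the assembly step in the generality the spine needs:

 * §1 an ABSTRACT TOWER over an arbitrary sequence of finite index types `ι k` (the level-`k` lattices), arbitrary
   one-step averaging operators `A k : ι k ← ι (k+1)` with `‖A k‖² ≤ r⁻¹` (`r = L^d`), composites `Atow A k : ι 0 ← ι k`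
   (`‖Atow A k‖² ≤ r^{−k}`), and the unit-lattice images `avgTow A r X k = r^k · (Atow A k) X_k (Atow A k)ᴴ` of a tower
   of level operators `X k`;
 * §2 the ONE-STEP AVERAGED LAW `OneStepAveragedLaw A r X e` (`‖A_k X_{k+1} A_kᴴ − r⁻¹X_k‖ ≤ r⁻¹·e_k`, a named `Prop`)
   and the kernel-checked reductions: telescoping `‖avgTow (k+1) − avgTow k‖ ≤ e_k` (`opNorm_avgTow_succ_sub_le`),
   convergence with the tail bound `Σ_{j ≥ k} e_j` when `e` is summable (`avgTow_tendsto_of_summable`), geometric rate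
   `C ρ^k/(1 − ρ)` when `e_k = Cρ^k` (`avgTow_tendsto_of_geom`, = the shape of [King1986] Lemma 4.5 (4.38)), and the
   two-level bound `‖avgTow k − avgTow (k+n)‖ ≤ Cρ^k/(1 − ρ)` (`opNorm_avgTow_sub_avgTow_le`);
 * §3 the NE2 INTERFACE: `TowerLimitRate A r X C ρ` (limit exists, rate `Cρ^k/(1−ρ)`) and the one theorem
   **`towerLimitRate_of_oneStepAveragedLaw`**.

WHY THE GENERALITY (the U ≠ 1 wall, typed).  At a non-trivial background the averaging operators of [B5]/[B9] are
COVARIANT, `Q(U)`, and change with the level (`A k = Q(U_k)` between the lattices of spacings `L^{−k−1}` and `L^{−k}`),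
and the items are the background propagators `X k = G_k(U_k), H_k(U_k), C^{(k)}(U_k)`.  NE2 proper (the cell's spine
estimate U1a at `U ≠ 1`, records `t4/T4-EST-U1a.md`, `t4/T4-EST-NE2-P1.md`) needs exactly an instance of
`OneStepAveragedLaw` for these families, with `e_k = C((B),(B^μ))·L^{−k}`: the ONE-STEP COVARIANT COMPARISON.  THAT
INEQUALITY IS NOT IN PRINT — [Balaban1984PropagatorsI], [Balaban1984PropagatorsII], [Balaban1985BackgroundPropagators] print
η-UNIFORM bounds only (cell GAPS G-t4-U1a-1), King's rates are scalar / abelian — and it is the cell's open row G-an2-4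
(BINDER-OWNERS.md).  This file does NOT assert it: `OneStepAveragedLaw` is a hypothesis shape; §3 is the bookkeeping
«NE2's operator-norm tower at U ≠ 1 ⇐ G-an2-4's one-step comparison», nothing more.  The carriers `G_k(U)`, `Q(U)` are not
constructed in the tree, so the wall is typed over ARBITRARY families — the honest maximum today.  At `U = 1` the law IS
a theorem for King's `Q` (the lineage's leaves above) and, from this generation, for Bałaban's own line-block averaging
(1.18) (`Support/BalabanLineAverage`, `Support/BalabanAveragedTowerUnit`, which instantiate §3).

HONEST FRAMING (T4-DAG p. 1).  Rung (B)+1 of the cell's ladder on a FIXED FINITE torus; linear (Gaussian) layer;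
operator-norm currency (no position-space decay, which the typed shape `T4EtaRate.NE2PlusOperator` also wants — sibling
lineage P2's currency); every statement here is [folklore]-level bookkeeping (geometric series in a complete normed
group), OURS, not a quotation; no conditional of the cell (`BetaPertH`, (B), (B^μ)) is used or hidden — at `U ≠ 1` they
would enter only through the constant of the hypothesis `OneStepAveragedLaw`, displayed by name by whoever instantiates
it.  NOT infinite volume, NOT a mass gap, NOT the Clay problem, NOT summit progress.  HONEST DEPENDENCY: continuum YM on T⁴
⇐ BetaPertH ∧ nine spine estimates (0/9 proved); BetaPertH ⇐ (D1) ∧ (D4) ∧ CAP+tail; G-an2-4 gates asym, D1 and NE2/3/4.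
ABSOLUTE RULE of the cell kept: no printed sentence is a hypothesis; imports Mathlib only.
-/

noncomputable section

open scoped Matrix Matrix.Norms.L2Operator
open Filter Topology

namespace Summit.QuantumFields.BalabanUV.T4Continuum.CovariantAveragingTower

variable {ι : ℕ → Type*} [∀ k, Fintype (ι k)] [∀ k, DecidableEq (ι k)]

/-! ## §1 The abstract tower: composites of one-step averagings and unit-lattice images -/

/-- the COMPOSITE AVERAGING from level `k` down to level `0`: `Atow A 0 = 1`, `Atow A (k+1) = Atow A k · A k`
(for `A k` = King's (2.10) block averaging this is `B5G183RateUnitTower.Qtow`; for Bałaban's (1.18) averaging see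
`Support/BalabanAveragedTowerUnit`). [folklore] -/
def Atow (A : (k : ℕ) → Matrix (ι k) (ι (k + 1)) ℂ) : (k : ℕ) → Matrix (ι 0) (ι k) ℂ
  | 0 => 1
  | k + 1 => Atow A k * A k

/-- the recursion step (definitional). [folklore] -/
@[simp] theorem Atow_succ (A : (k : ℕ) → Matrix (ι k) (ι (k + 1)) ℂ) (k : ℕ) :
    Atow A (k + 1) = Atow A k * A k := rfl

/-- `Atow A 0 = 1` (definitional). [folklore] -/
@[simp] theorem Atow_zero (A : (k : ℕ) → Matrix (ι k) (ι (k + 1)) ℂ) : Atow A 0 = 1 := rfl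

omit [∀ k, DecidableEq (ι k)] in
/-- `‖1‖ ≤ 1` for the `ℓ²`-operator norm on a finite index type (also when the type is empty). [folklore] -/
theorem opNorm_one_le (k : ℕ) [DecidableEq (ι k)] : ‖(1 : Matrix (ι k) (ι k) ℂ)‖ ≤ 1 := by
  rw [Matrix.cstar_norm_def, map_one]
  exact ContinuousLinearMap.norm_id_le

/-- **`‖Atow A k‖² ≤ r^{−k}`** from the one-step bound `‖A k‖² ≤ r⁻¹` (`r > 0`; `r = L^d` for `L`-block averagings,
whose rows are orthogonal with squared norm `L^{−d}`). [folklore] -/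
theorem opNorm_Atow_sq_le (A : (k : ℕ) → Matrix (ι k) (ι (k + 1)) ℂ) {r : ℝ} (hr : 0 < r)
    (hA : ∀ k, ‖A k‖ ^ 2 ≤ r⁻¹) (k : ℕ) : ‖Atow A k‖ ^ 2 ≤ (r ^ k)⁻¹ := by
  induction k with
  | zero =>
    rw [pow_zero, inv_one, Atow_zero]
    calc ‖(1 : Matrix (ι 0) (ι 0) ℂ)‖ ^ 2 ≤ (1 : ℝ) ^ 2 :=
          pow_le_pow_left₀ (norm_nonneg _) (opNorm_one_le (ι := ι) 0) 2
      _ = 1 := one_pow 2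
  | succ k ih =>
    rw [Atow_succ]
    calc ‖Atow A k * A k‖ ^ 2 ≤ (‖Atow A k‖ * ‖A k‖) ^ 2 :=
          pow_le_pow_left₀ (norm_nonneg _) (Matrix.l2_opNorm_mul _ _) 2
      _ = ‖Atow A k‖ ^ 2 * ‖A k‖ ^ 2 := mul_pow _ _ 2
      _ ≤ (r ^ k)⁻¹ * r⁻¹ := mul_le_mul ih (hA k) (sq_nonneg _) (inv_nonneg.mpr (pow_nonneg hr.le k))
      _ = (r ^ (k + 1))⁻¹ := by rw [pow_succ, mul_inv]

/-- the UNIT-LATTICE IMAGE of a tower of level operators `X k`: `r^k · (Atow A k) X_k (Atow A k)ᴴ` (the factor `r^k`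
compensates `‖Atow A k‖² ≤ r^{−k}`; for `A` = King's block averagings and `X k = 𝒢^{(L^{−k})}` this is the
block-averaged free covariance on the unit lattice, `B5G183RateUnitTower.unitCov`). [folklore] -/
def avgTow (A : (k : ℕ) → Matrix (ι k) (ι (k + 1)) ℂ) (r : ℝ) (X : (k : ℕ) → Matrix (ι k) (ι k) ℂ) (k : ℕ) :
    Matrix (ι 0) (ι 0) ℂ :=
  ((r : ℂ) ^ k) • (Atow A k * X k * (Atow A k)ᴴ)

/-! ## §2 The one-step averaged law (hypothesis shape) and what it yields -/

/-- **THE ONE-STEP AVERAGED LAW** with error sequence `e`: at every level,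
`‖A_k X_{k+1} A_kᴴ − r⁻¹·X_k‖ ≤ r⁻¹·e_k`.
AT `U = 1` this is a THEOREM for the six items of [B5] (1.89) against King's block averaging (lineage leaves
`B5G183RateTorusW` §7/§9, `B5G183RateUnitTower` §4/§6/§8; `e_k = C·L^{−k}` or `C·L^{−min(2θ,1)k}`) and for Bałaban's (1.18)
averaging (`Support/BalabanLineAverage.opNorm_QB_calG_rate`).  AT `U ≠ 1` (covariant averagings `A k = Q(U_k)`, items
`X k = G_k(U_k), H_k(U_k), C^{(k)}(U_k)`) it is the cell's ONE-STEP COVARIANT COMPARISON — NOT IN PRINT, open row G-an2-4;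
a HYPOTHESIS SHAPE here, asserted by nobody. [folklore] -/
def OneStepAveragedLaw (A : (k : ℕ) → Matrix (ι k) (ι (k + 1)) ℂ) (r : ℝ) (X : (k : ℕ) → Matrix (ι k) (ι k) ℂ)
    (e : ℕ → ℝ) : Prop :=
  ∀ k, ‖A k * X (k + 1) * (A k)ᴴ - ((r : ℂ))⁻¹ • X k‖ ≤ r⁻¹ * e k

/-- **Core of the tower step** (no recursion, any sandwich `Q₀` with `‖Q₀‖² ≤ w⁻¹`): `‖(w·r)·(Q₀A)X₁(Q₀A)ᴴ −
w·Q₀X₀Q₀ᴴ‖ ≤ r·‖A X₁ Aᴴ − r⁻¹X₀‖`. [folklore] -/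
theorem opNorm_sandwich_step_le {κ α β : Type*} [Fintype κ] [DecidableEq κ] [Fintype α] [DecidableEq α]
    [Fintype β] [DecidableEq β] (Q₀ : Matrix κ α ℂ) (A : Matrix α β ℂ) (X₁ : Matrix β β ℂ) (X₀ : Matrix α α ℂ)
    {w r : ℝ} (hw : 0 < w) (hr : 0 < r) (hQ : ‖Q₀‖ ^ 2 ≤ w⁻¹) :
    ‖(((w * r : ℝ) : ℂ)) • (Q₀ * A * X₁ * (Q₀ * A)ᴴ) - ((w : ℝ) : ℂ) • (Q₀ * X₀ * Q₀ᴴ)‖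
      ≤ r * ‖A * X₁ * Aᴴ - ((r : ℂ))⁻¹ • X₀‖ := by
  have hrC : ((r : ℝ) : ℂ) ≠ 0 := by exact_mod_cast hr.ne'
  set E := A * X₁ * Aᴴ - ((r : ℂ))⁻¹ • X₀ with hE
  have key : (((w * r : ℝ) : ℂ)) • (Q₀ * A * X₁ * (Q₀ * A)ᴴ) - ((w : ℝ) : ℂ) • (Q₀ * X₀ * Q₀ᴴ)
      = (((w * r : ℝ) : ℂ)) • (Q₀ * E * Q₀ᴴ) := by
    rw [hE, Matrix.conjTranspose_mul, Matrix.mul_sub, Matrix.sub_mul, smul_sub, Matrix.mul_smul,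
      Matrix.smul_mul, smul_smul]
    congr 1
    · simp only [Matrix.mul_assoc]
    · congr 1
      push_cast
      rw [mul_assoc, mul_inv_cancel₀ hrC, mul_one]
  rw [key, norm_smul]
  have hn : ‖(((w * r : ℝ) : ℂ))‖ = w * r := by
    rw [Complex.norm_real, Real.norm_of_nonneg (mul_pos hw hr).le]
  rw [hn]
  calc w * r * ‖Q₀ * E * Q₀ᴴ‖ ≤ w * r * (‖Q₀‖ * ‖E‖ * ‖Q₀‖) := by
        refine mul_le_mul_of_nonneg_left ?_ (by positivity)
        calc ‖Q₀ * E * Q₀ᴴ‖ ≤ ‖Q₀ * E‖ * ‖Q₀ᴴ‖ := Matrix.l2_opNorm_mul _ _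
          _ ≤ ‖Q₀‖ * ‖E‖ * ‖Q₀‖ := by
              rw [Matrix.l2_opNorm_conjTranspose]
              exact mul_le_mul_of_nonneg_right (Matrix.l2_opNorm_mul _ _) (norm_nonneg _)
    _ = w * ‖Q₀‖ ^ 2 * (r * ‖E‖) := by ring
    _ ≤ w * w⁻¹ * (r * ‖E‖) := by gcongr
    _ = r * ‖E‖ := by rw [mul_inv_cancel₀ hw.ne', one_mul]

/-- **Abstract tower step**: under the one-step law at level `k` and `‖A j‖² ≤ r⁻¹` for all `j`,
`‖avgTow (k+1) − avgTow k‖ ≤ e_k`. [folklore] -/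
theorem opNorm_avgTow_succ_sub_le (A : (k : ℕ) → Matrix (ι k) (ι (k + 1)) ℂ) {r : ℝ} (hr : 0 < r)
    (hA : ∀ k, ‖A k‖ ^ 2 ≤ r⁻¹) (X : (k : ℕ) → Matrix (ι k) (ι k) ℂ) {e : ℕ → ℝ} (k : ℕ)
    (hX : ‖A k * X (k + 1) * (A k)ᴴ - ((r : ℂ))⁻¹ • X k‖ ≤ r⁻¹ * e k) :
    ‖avgTow A r X (k + 1) - avgTow A r X k‖ ≤ e k := by
  have hw : 0 < r ^ k := pow_pos hr k
  have h := opNorm_sandwich_step_le (Atow A k) (A k) (X (k + 1)) (X k) hw hr (opNorm_Atow_sq_le A hr hA k)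
  have e1 : (((r ^ k * r : ℝ) : ℂ)) = (r : ℂ) ^ (k + 1) := by push_cast; rw [pow_succ]
  have e2 : (((r ^ k : ℝ) : ℂ)) = (r : ℂ) ^ k := by push_cast; rfl
  rw [e1, e2] at h
  calc ‖avgTow A r X (k + 1) - avgTow A r X k‖
      = ‖((r : ℂ) ^ (k + 1)) • (Atow A k * A k * X (k + 1) * (Atow A k * A k)ᴴ)
          - ((r : ℂ) ^ k) • (Atow A k * X k * (Atow A k)ᴴ)‖ := by rfl
    _ ≤ r * ‖A k * X (k + 1) * (A k)ᴴ - ((r : ℂ))⁻¹ • X k‖ := h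
    _ ≤ r * (r⁻¹ * e k) := mul_le_mul_of_nonneg_left hX hr.le
    _ = e k := by rw [← mul_assoc, mul_inv_cancel₀ hr.ne', one_mul]

/-- **Convergence under a SUMMABLE one-step law**: the unit-lattice images converge and
`‖avgTow k − lim‖ ≤ Σ_{m} e_{k+m}` (the tail of the error series). [folklore] -/
theorem avgTow_tendsto_of_summable (A : (k : ℕ) → Matrix (ι k) (ι (k + 1)) ℂ) {r : ℝ} (hr : 0 < r)
    (hA : ∀ k, ‖A k‖ ^ 2 ≤ r⁻¹) (X : (k : ℕ) → Matrix (ι k) (ι k) ℂ) {e : ℕ → ℝ}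
    (hlaw : OneStepAveragedLaw A r X e) (he : Summable e) :
    ∃ Xlim : Matrix (ι 0) (ι 0) ℂ,
      Tendsto (avgTow A r X) atTop (𝓝 Xlim) ∧ ∀ k, ‖avgTow A r X k - Xlim‖ ≤ ∑' m, e (k + m) := by
  have hu : ∀ k, dist (avgTow A r X k) (avgTow A r X k.succ) ≤ e k := by
    intro k
    rw [dist_eq_norm, ← norm_neg, neg_sub]
    exact opNorm_avgTow_succ_sub_le A hr hA X (e := e) k (hlaw k)
  have hcs := cauchySeq_of_dist_le_of_summable e hu he
  obtain ⟨Xlim, hlim⟩ := cauchySeq_tendsto_of_complete hcs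
  refine ⟨Xlim, hlim, fun k => ?_⟩
  rw [← dist_eq_norm]
  exact dist_le_tsum_of_dist_le_of_tendsto e hu he hlim k

/-- **Convergence under a GEOMETRIC one-step law** `e_k = C ρ^k`, `ρ < 1`: the unit-lattice images converge with
`‖avgTow k − lim‖ ≤ C ρ^k/(1 − ρ)` — the shape of «|C^{(k)}(x, y) − C^{(k+n)}(x, y)| ≤ CL^{−k}e^{−δ₀|x−y|}» ([King1986]
Lemma 4.5 (4.38), scalar, with decay) in operator norm, for any averaging tower; statement ours. [folklore] -/
theorem avgTow_tendsto_of_geom (A : (k : ℕ) → Matrix (ι k) (ι (k + 1)) ℂ) {r : ℝ} (hr : 0 < r)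
    (hA : ∀ k, ‖A k‖ ^ 2 ≤ r⁻¹) (X : (k : ℕ) → Matrix (ι k) (ι k) ℂ) {C ρ : ℝ} (hρ1 : ρ < 1)
    (hlaw : OneStepAveragedLaw A r X (fun k => C * ρ ^ k)) :
    ∃ Xlim : Matrix (ι 0) (ι 0) ℂ,
      Tendsto (avgTow A r X) atTop (𝓝 Xlim) ∧ ∀ k, ‖avgTow A r X k - Xlim‖ ≤ C * ρ ^ k / (1 - ρ) := by
  have hu : ∀ k, dist (avgTow A r X k) (avgTow A r X (k + 1)) ≤ C * ρ ^ k := by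
    intro k
    rw [dist_eq_norm, ← norm_neg, neg_sub]
    exact opNorm_avgTow_succ_sub_le A hr hA X (e := fun k => C * ρ ^ k) k (hlaw k)
  have hcs := cauchySeq_of_le_geometric ρ C hρ1 hu
  obtain ⟨Xlim, hlim⟩ := cauchySeq_tendsto_of_complete hcs
  refine ⟨Xlim, hlim, fun k => ?_⟩
  rw [← dist_eq_norm]
  exact dist_le_of_le_geometric_of_tendsto ρ C hρ1 hu hlim k

/-- **Two finite levels** ((4.38) shape): under the geometric law, `‖avgTow k − avgTow (k+n)‖ ≤ Cρ^k/(1 − ρ)` for all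
`k, n` (`0 ≤ ρ < 1`); statement ours. [folklore] -/
theorem opNorm_avgTow_sub_avgTow_le (A : (k : ℕ) → Matrix (ι k) (ι (k + 1)) ℂ) {r : ℝ} (hr : 0 < r)
    (hA : ∀ k, ‖A k‖ ^ 2 ≤ r⁻¹) (X : (k : ℕ) → Matrix (ι k) (ι k) ℂ) {C ρ : ℝ} (hρ0 : 0 ≤ ρ) (hρ1 : ρ < 1)
    (hlaw : OneStepAveragedLaw A r X (fun k => C * ρ ^ k)) (k n : ℕ) :
    ‖avgTow A r X k - avgTow A r X (k + n)‖ ≤ C * ρ ^ k / (1 - ρ) := by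
  have hu : ∀ m, dist (avgTow A r X m) (avgTow A r X (m + 1)) ≤ C * ρ ^ m := by
    intro m
    rw [dist_eq_norm, ← norm_neg, neg_sub]
    exact opNorm_avgTow_succ_sub_le A hr hA X (e := fun k => C * ρ ^ k) m (hlaw m)
  have hC : 0 ≤ C := by
    have h0 : (0 : ℝ) ≤ C * ρ ^ 0 := dist_nonneg.trans (hu 0)
    simpa using h0
  rw [← dist_eq_norm]
  calc dist (avgTow A r X k) (avgTow A r X (k + n))
      ≤ ∑ i ∈ Finset.Ico k (k + n), C * ρ ^ i :=
        dist_le_Ico_sum_of_dist_le (Nat.le_add_right k n) (fun {m} _ _ => hu m)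
    _ = C * ∑ i ∈ Finset.Ico k (k + n), ρ ^ i := by rw [Finset.mul_sum]
    _ ≤ C * (ρ ^ k / (1 - ρ)) := mul_le_mul_of_nonneg_left (geom_sum_Ico_le_of_lt_one hρ0 hρ1) hC
    _ = C * ρ ^ k / (1 - ρ) := by ring

/-! ## §3 The NE2 interface: tower limit with rate ⇐ the one-step averaged law -/

/-- **NE2's operator-norm tower conclusion** for a pair (averagings `A`, items `X`): the unit-lattice images converge
AND `‖avgTow k − lim‖ ≤ Cρ^k/(1 − ρ)` for every `k` (existence of the `k → ∞` limit of the averaged level-`k` object seen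
on the unit lattice, with a geometric rate — the currency the spine's Cauchy sums consume, θ = ρ). [folklore] -/
def TowerLimitRate (A : (k : ℕ) → Matrix (ι k) (ι (k + 1)) ℂ) (r : ℝ) (X : (k : ℕ) → Matrix (ι k) (ι k) ℂ)
    (C ρ : ℝ) : Prop :=
  ∃ Xlim : Matrix (ι 0) (ι 0) ℂ,
    Tendsto (avgTow A r X) atTop (𝓝 Xlim) ∧ ∀ k, ‖avgTow A r X k - Xlim‖ ≤ C * ρ ^ k / (1 - ρ)

/-- **THE REDUCTION** (kernel-checked bookkeeping): averagings with `‖A k‖² ≤ r⁻¹` and the one-step averaged law with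
geometric errors `Cρ^k`, `ρ < 1`, give the tower limit with rate.  At `U ≠ 1` this is exactly «NE2's operator-norm
tower ⇐ G-an2-4's one-step covariant comparison»; at `U = 1` it is instantiated unconditionally in
`Support/BalabanAveragedTowerUnit`. [folklore] -/
theorem towerLimitRate_of_oneStepAveragedLaw (A : (k : ℕ) → Matrix (ι k) (ι (k + 1)) ℂ) {r : ℝ} (hr : 0 < r)
    (hA : ∀ k, ‖A k‖ ^ 2 ≤ r⁻¹) (X : (k : ℕ) → Matrix (ι k) (ι k) ℂ) {C ρ : ℝ} (hρ1 : ρ < 1)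
    (hlaw : OneStepAveragedLaw A r X (fun k => C * ρ ^ k)) : TowerLimitRate A r X C ρ :=
  avgTow_tendsto_of_geom A hr hA X hρ1 hlaw

/-- the limit of §3 is NONDEGENERATE on any common eigen-direction: if every `avgTow k` fixes a vector `v` up to the
same scalar `c` (e.g. constants, `c = a⁻¹`, [B5] (1.82) at `U = 1`), so does the limit. [folklore] -/
theorem limit_mulVec_of_forall {A : (k : ℕ) → Matrix (ι k) (ι (k + 1)) ℂ} {r : ℝ} {X : (k : ℕ) → Matrix (ι k) (ι k) ℂ}
    {Xlim : Matrix (ι 0) (ι 0) ℂ} (hlim : Tendsto (avgTow A r X) atTop (𝓝 Xlim)) (v w : ι 0 → ℂ)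
    (hv : ∀ k, (avgTow A r X k).mulVec v = w) : Xlim.mulVec v = w := by
  have hcont : Continuous fun Y : Matrix (ι 0) (ι 0) ℂ => Y.mulVec v :=
    Continuous.matrix_mulVec continuous_id continuous_const
  have h1 : Tendsto (fun k => (avgTow A r X k).mulVec v) atTop (𝓝 (Xlim.mulVec v)) :=
    (hcont.tendsto Xlim).comp hlim
  have h2 : Tendsto (fun k => (avgTow A r X k).mulVec v) atTop (𝓝 w) := by
    simp_rw [hv]; exact tendsto_const_nhds
  exact tendsto_nhds_unique h1 h2

end Summit.QuantumFields.BalabanUV.T4Continuum.CovariantAveragingTower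

end
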